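import Mathlib
import HarnessLib
import Literature.RingTheory.CohomologyAnnihilator.Basic
import Literature.AlgebraicGeometry.Morphisms.CechModule
import Literature.AlgebraicGeometry.Modules.AffineLocalizing
import Literature.AlgebraicGeometry.Resolution.ReflexiveModulesRationalDoublePoints
import Literature.AlgebraicGeometry.Resolution.Lipman1969RationalSurfaceSingularities
import Summits.ResolutionOfSingularities.ResolutionOfSingularities.Theorems.HomologicalConductorNoZenoCaCarriedAssembly
import Summits.ResolutionOfSingularities.ResolutionOfSingularities.Theorems.HomologicalConductorNoZenoCaStableAnnFamily
import Summits.ResolutionOfSingularities.ResolutionOfSingularities.Theorems.HomologicalConductorNoZenoOrdNonneg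
import Summits.ResolutionOfSingularities.ResolutionOfSingularities.Theorems.HomologicalConductorNoZenoSandwichClusterDefs
import Summits.ResolutionOfSingularities.ResolutionOfSingularities.Theorems.HomologicalConductorNoZenoDim2RegularCentre
import Summits.ResolutionOfSingularities.ResolutionOfSingularities.Theorems.HomologicalConductorNoZenoTowerNoetherian

/-!
# Crux `NoZenoR` / `NoZeno` (stmt-ResolutionOfSingularities-19943 / -16483), line `sandwich-cluster`,
# G-layer: Ga «`ca(T_m)` is `X_min`-carried» AT THE STAGE, from the seats' typed inputs
# (lead res-L0-w44-lead-1; skeleton v19/v20 `Sig.stubG_caCarried`; KERNEL-L0 §19)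

Route `ResolutionOfSingularities/HomologicalConductor`.  OURS (cell res-hironaka, crux chain W4.4); nothing
here is a statement of the manuscript under review (Hironaka 2017); AI-written, weaker than expert review.

`caCarried_tower_of_inputs`: the skeleton's Ga at the stage `T_m = tower O A m` (registered binders of
`Sig.stubG_caCarried` after the fact bundle: `SandwichCtx`, `m ≥ m₀ + 1`, `T_m` singular, a minimal
resolution `π : X ⟶ Spec T_m`), from
* the CA-layer IN THE TREE (res-L0-w44-stub-5, `exists_mem_cohomologyAnnihilator_iff_forall_stableAnnIdeals`,
  `stableAnnModule_spec`: `ca(T_m) = ⋂_j ann End̲(N_j)` over finitely generated reflexive `N_j` with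
  `Ext¹(N_j, T_m) = 0`),
* the glue IN THE TREE (lead, `caCarried_of_pieces`, `ord_baseToFunctionField_nonneg`),
* and, AS HYPOTHESES IN THEIR OWNERS' SHAPES, the three inputs still in flight: `hG2` (stub-8's G2-MAIN
  `exists_locallyFree_stableEnd_equiv_cechMH1`, consumed form), `hL` (stub-2's LEMMA L with its geometric side
  conditions discharged — stub-3, stub-4, stub-7 dictionary — quantified over every finite affine cover), `hdict`
  (`excCurvePoints π = excPoints π`), `hdim2` (the singular normal stage is two-dimensional), `hc`/`y`
  (`𝔪^c ⊆ ca ∋ y ≠ 0`, stub-5's CaPrimaryTower).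
Output: the body of `Sig.stubG_caCarried` — `∃ Z, t ∈ ca(T_m) ↔ ((t:K) = 0 ∨ ∀ η ∈ excCurvePoints π, Z η ≤ ord_η t)`.

References: J. Lipman, Publ. IHÉS 36 (1969), §18 [`Lipman1969`]; S. Iyengar, R. Takahashi, IMRN 2016, Def. 2.1
[`IyengarTakahashi2014`].
-/

noncomputable section

-- single-problem summit: the doubled namespace component `ResolutionOfSingularities` is forced
set_option linter.dupNamespace false

namespace Summit.ResolutionOfSingularities.ResolutionOfSingularities.Theorems.NoZeno.SandwichCluster

open CategoryTheory CategoryTheory.Abelian AlgebraicGeometry TopologicalSpace IsLocalRing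
open Literature.RingTheory.CohomologyAnnihilator (cohomologyAnnihilator)
open Literature.AlgebraicGeometry.Morphisms Literature.AlgebraicGeometry.Modules
open Literature.AlgebraicGeometry.Resolution
open Summit.ResolutionOfSingularities.ResolutionOfSingularities.Theorems.NoZeno.Birth

variable {k K : Type} [Field k] [Field K] [Algebra k K]

/-- **Ga at the stage, from the typed inputs** (KERNEL-L0 §19).  For a singular sandwiched stage `T_m` and
a minimal resolution `π : X ⟶ Spec T_m`: if (hG2) every finitely generated reflexive `T_m`-module `M` with
`Ext¹(M, T_m) = 0` has an affine-localizing sheaf `F` with `End̲(M) ≃ Ȟ¹(𝒰, F)` on every finite affine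
cover, (hL) LEMMA L holds on `X` for affine-localizing sheaves on every finite affine cover, (hdict) the two
indexings of the exceptional curves agree, the stage is two-dimensional and `𝔪^c ⊆ ca(T_m) ∋ y ≠ 0`, then
`ca(T_m)` is `X`-carried: ONE cycle `Z` with `t ∈ ca(T_m) ↔ ((t : K) = 0 ∨ ∀ η ∈ excCurvePoints π,
Z η ≤ ord_η t)`. [this work] -/
theorem caCarried_tower_of_inputs (O : ValuationSubring K) (A R : Subalgebra k K) (m₀ : ℕ)
    (ctx : SandwichCtx O A R m₀) (m : ℕ) (hm : m₀ + 1 ≤ m)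
    (_hsing : ¬ IsRegularLocalRing ↥(tower O A m)) [IsLocalRing ↥(tower O A m)]
    (X : Scheme.{0}) [IsIntegral X] [IsLocallyNoetherian X]
    (π : X ⟶ Spec (.of ↥(tower O A m))) (hπ : IsMinimalResolution π)
    (hdim2 : ringKrullDim ↥(tower O A m) = 2)
    -- G2-MAIN (stub-8), consumed form
    (hG2 : ∀ (M : Type) [AddCommGroup M] [Module ↥(tower O A m) M] [Module.Finite ↥(tower O A m) M],
      Module.IsReflexive ↥(tower O A m) M →
      (∀ e : Ext (ModuleCat.of ↥(tower O A m) M) (ModuleCat.of ↥(tower O A m) ↥(tower O A m)) 1, e = 0) →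
      ∃ F : X.Modules, IsAffineLocalizing F ∧
        ∀ (ι : Type) [Finite ι] (U : ι → X.Opens), (∀ i, IsAffineOpen (U i)) → ⨆ i, U i = ⊤ →
          Nonempty (StableEnd ↥(tower O A m) M ≃ₗ[↥(tower O A m)] CechMH1 π F U))
    -- LEMMA L (stub-2), side conditions discharged, every finite affine cover
    (hL : ∀ (F : X.Modules), IsAffineLocalizing F →
      ∀ (ι : Type) [Finite ι] (U : ι → X.Opens), (∀ i, IsAffineOpen (U i)) → ⨆ i, U i = ⊤ →
      ∀ c : ℕ, maximalIdeal ↥(tower O A m) ^ c ≤ Module.annihilator ↥(tower O A m) (CechMH1 π F U) →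
      ∀ t : ↥(tower O A m), (∀ η ∈ excPoints π, ∃ a ∈ Module.annihilator ↥(tower O A m) (CechMH1 π F U),
        a ≠ 0 ∧ Scheme.ord (baseToFunctionField π a) η ≤ Scheme.ord (baseToFunctionField π t) η) →
        t ∈ Module.annihilator ↥(tower O A m) (CechMH1 π F U))
    -- dictionary (stub-3, stub-4)
    (hdict : excCurvePoints π = excPoints π)
    -- `ca` is `𝔪`-primary with a non-zero element (stub-5, CaPrimaryTower)
    (c : ℕ) (hc : maximalIdeal ↥(tower O A m) ^ c ≤ cohomologyAnnihilator ↥(tower O A m))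
    (y : ↥(tower O A m)) (hy0 : y ≠ 0) (hy : y ∈ cohomologyAnnihilator ↥(tower O A m)) :
    ∃ Z : X → ℕ, ∀ t : ↥(tower O A m),
      t ∈ cohomologyAnnihilator ↥(tower O A m) ↔
        ((t : K) = 0 ∨ ∀ η ∈ excCurvePoints π,
          (Z η : ℤ) ≤ Scheme.ord (baseToFunctionField π t) η) := by
  classical
  obtain ⟨hk, hA, hfr, hAO, -⟩ := id ctx
  obtain ⟨n, rfl⟩ : ∃ n, m = n + 1 := ⟨m - 1, by omega⟩
  haveI := hfr
  haveI : IsNoetherianRing ↥(tower O A (n + 1)) := stub_towerNoetherian k K O A hk hA hfr hAO _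
  haveI : IsIntegrallyClosed ↥(tower O A (n + 1)) := d2rc_isIntegrallyClosed_tower_succ O A hk hA hfr hAO n
  -- a finite affine open cover of the (quasi-compact) resolution
  haveI : IsProper π := hπ.1.isProper
  haveI : CompactSpace X := QuasiCompact.compactSpace_of_compactSpace π
  obtain ⟨S, hS, hcov⟩ := (isCompact_iff_finite_and_eq_biUnion_affineOpens (U := (⊤ : X.Opens))).mp
    (CompactSpace.isCompact_univ (X := X))
  haveI : Finite S := hS.to_subtype
  let U : S → X.Opens := fun i => (i.1 : X.Opens)
  have hUaff : ∀ i, IsAffineOpen (U i) := fun i => i.1.2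
  have hUcov : ⨆ i, U i = ⊤ := by
    change ⨆ i : S, ((i.1 : X.affineOpens) : X.Opens) = ⊤
    rw [iSup_subtype'', ← hcov]
  -- the CA-layer family (stub-5)
  obtain ⟨N, hN4, -, hca⟩ :=
    exists_mem_cohomologyAnnihilator_iff_forall_stableAnnIdeals (T := ↥(tower O A (n + 1)))
  -- G2 for each member of the family
  have hG2' : ∀ j : stableAnnIdeals ↥(tower O A (n + 1)) N, ∃ F : X.Modules, IsAffineLocalizing F ∧
      Nonempty (StableEnd ↥(tower O A (n + 1)) (stableAnnModule j) ≃ₗ[↥(tower O A (n + 1))]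
        CechMH1 π F U) := fun j => by
    obtain ⟨hfin, hrefl, hW⟩ := stableAnnModule_spec (T := ↥(tower O A (n + 1))) hdim2 hN4 j
    haveI := hfin
    obtain ⟨F, hFaff, hF⟩ := hG2 (stableAnnModule j) hrefl hW
    exact ⟨F, hFaff, hF S U hUaff hUcov⟩
  -- the glue
  obtain ⟨Z, hZ⟩ := caCarried_of_pieces π U
    (fun t _ η _ => ord_baseToFunctionField_nonneg π t η)
    (N := fun j : stableAnnIdeals ↥(tower O A (n + 1)) N => stableAnnModule j) hca hG2'
    (fun F hF c' hc' t ht => hL F hF S U hUaff hUcov c' hc' t ht) c hc y hy0 hy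
  refine ⟨Z, fun t => ?_⟩
  rw [hZ t, hdict]
  have h0 : (t = 0) ↔ ((t : K) = 0) := by
    rw [← ZeroMemClass.coe_eq_zero]
  rw [h0]

end Summit.ResolutionOfSingularities.ResolutionOfSingularities.Theorems.NoZeno.SandwichCluster

end
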